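import Summits.HubbardSuperconductivity.HubbardSuperconductivity.Theorems.BirGroundStateAverageLRO.Negative.LoadBearing
import Literature.MathematicalPhysics.QuantumLattice.FreeFermiGasPairingCost

/-!
# Crux `BirGroundStateAverageLRO` (item `stmt-HubbardSuperconductivity-2079`): the window floor is UNCONDITIONAL

The crux (`Theses.BalabanIR.BirGroundStateAverageLRO`, route BalabanIR, target / rank 0) asks, on a
window of couplings `0 < U₁ < U < U₂`, eventually in even `L`, the ground-state-AVERAGE `d`-wave pair
LRO `c·L⁴·Re tr P ≤ Re tr (P Δ_d† Δ_d)` for the projection `P` onto the ground eigenspace of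
`hubbardTorus 2 L 1 U` in the sector `(2⌊(1-δ)L²/2⌋, S^z = 0)`.

`Negative/LoadBearing.lean` (standing disprover) proved the window floor `η(c) ≤ U₁` and
`¬FromZero` MODULO the free-fermion energy inequality "`d`-wave pair LRO of density `a` in the free
Fermi sea costs kinetic energy `≥ η(a)·L²`" (there attributed to BCS mean-field asymptotics). That
inequality is now a THEOREM of the tree (`Literature/…/FreeFermiGasPairingCost.lean`,
`freeDWavePairing_costs_energy`, elementary: pair Gram bounds + bathtub bound + uniform shell count,
`η(a) = 4(min(a,1)/48)⁶`). Consequences recorded here (negative side only; nothing asserts a Theses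
decl; every mutated statement is spelled out):

* `birGroundStateAverageLRO_window_floor_unconditional` — every witness `(δ, U₁, U₂, c)` of the crux
  (indeed of its weakening with `0 ≤ U₁`) satisfies `4·(min(c,1)/48)⁶ ≤ U₁`: the admissible constant
  degrades at least like `c ≤ 48·(U₁/4)^{1/6}` as the window approaches the free point.
* `not_birGroundStateAverageLRO_fromZero` — the STRENGTHENING of the crux with window `(0, U₂)` and
  one constant down to `U → 0⁺` is FALSE, unconditionally (was `…_of_pairingCost`).
* `avgBound_coupling_floor` — POINTWISE a-priori bound, no window, no parity, no `L → ∞`: if the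
  crux's inequality holds at ONE `(δ, U, c, L)` with `δ ≥ -1`, `U ≥ 0`, `c > 0` and
  `L ≥ ⌈384/c⌉ + 3`, then `4·(min(c,1)/48)⁶ ≤ U`. Equivalently: the ground-state-average `d`-wave
  pair density of the repulsive Hubbard torus at coupling `U` is `< c` whenever
  `U < 4(min(c,1)/48)⁶` — the first unconditional upper bound on the target functional in the tree
  (far from the expected truth `c(U) ~ e^{-O(1/U²)}`, `PerturbativeInvisibilityOfPairing`, but of the
  right monotone shape).

Mechanism: an interacting sector ground state at coupling `U ≥ 0` has free kinetic energy at most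
`U·L²` above the free sector ground energy (`re_free_energy_groundState_le`, variational principle,
`0 ≤ Σ n↑n↓ ≤ L²`), while pair LRO of density `c` forces an excess `≥ 4(min(c,1)/48)⁶·L²`
(`freeDWavePairing_costs_energy_rate`).

Sources: Bardeen–Cooper–Schrieffer, Phys. Rev. 108 (1957) 1175, §II; C. N. Yang, Rev. Mod. Phys. 34
(1962) 694, §3; Tasaki (2020) §2.2 (variational principle). Folklore finite-dimensional statements;
no named facts, no definitions.
-/

noncomputable section

namespace Summit.HubbardSuperconductivity.HubbardSuperconductivity.Theorems.BirGroundStateAverageLRO.Negative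

open Matrix Finset Filter
open Literature.Probability.LatticeModels Literature.MathematicalPhysics.QuantumLattice
open Summit.HubbardSuperconductivity.HubbardSuperconductivity.Theorems
open scoped ComplexOrder

/-- **Pointwise coupling floor.** If the crux's ground-state-average bound
`c·L⁴·Re tr P ≤ Re tr (P Δ_d†Δ_d)` holds at ONE datum `(δ, U, c, L)` with `δ ≥ -1`, `U ≥ 0`, `c > 0`
and `L ≥ ⌈384/c⌉ + 3`, then `4·(min(c,1)/48)⁶ ≤ U`: a sector ground state carrying the bound
(`exists_groundState_le_of_trace_bound`) has free-energy excess `≤ U·L²`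
(`re_free_energy_groundState_le`) and `≥ 4(min(c,1)/48)⁶·L²` (`freeDWavePairing_costs_energy_rate`).
[folklore] -/
theorem avgBound_coupling_floor (L : ℕ) [NeZero L] {δ U c : ℝ} (hδ : -1 ≤ δ) (hU : 0 ≤ U)
    (hc : 0 < c) (hL : ⌈384 / c⌉₊ + 3 ≤ L)
    (h : let N : ℕ := 2 * ⌊(1 - δ) * (L : ℝ) ^ 2 / 2⌋₊
      let H := hubbardTorus 2 L 1 U
      let S := szSector (Λ := FermionTorus 2 L) N 0
      let E₀ := S ⊓ Module.End.eigenspace (Matrix.toLin' H) ((H.minEnergyOn S : ℝ) : ℂ)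
      let P := projMatrix (E₀.map (Fock.toEuclidean (ι := Orb (FermionTorus 2 L)) :
        Fock (Orb (FermionTorus 2 L)) →ₗ[ℂ] EuclideanSpace ℂ (Finset (Orb (FermionTorus 2 L)))))
      c * (L : ℝ) ^ 4 * P.trace.re ≤
        (P * ((pairField dWaveFormFactor L)ᴴ * pairField dWaveFormFactor L)).trace.re) :
    4 * (min c 1 / 48) ^ 6 ≤ U := by
  obtain ⟨ψ, hgs, h1, hle⟩ := exists_groundState_le_of_trace_bound L 1 U δ c hδ h
  have hn := NoGo.floor_pairNumber_le δ hδ L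
  have hcost := freeDWavePairing_costs_energy_rate hc hL hgs.1 h1 hle
  have hfree := re_free_energy_groundState_le L 1 U hU hn hgs h1
  have hL2 : (0 : ℝ) < (L : ℝ) ^ 2 := by
    have : (0 : ℝ) < (L : ℝ) := by exact_mod_cast Nat.pos_of_ne_zero (NeZero.ne L)
    positivity
  have hmul : 4 * (min c 1 / 48) ^ 6 * (L : ℝ) ^ 2 ≤ U * (L : ℝ) ^ 2 := by linarith
  exact le_of_mul_le_mul_right hmul hL2

/-- **Window floor for `BirGroundStateAverageLRO`, unconditional.** If the crux's average bound with
constant `c > 0` holds eventually in even `L` at every coupling of an interval `(U₁, U₂)`,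
`0 ≤ U₁ < U₂` (`δ ∈ (0,1/2)`), then `4·(min(c,1)/48)⁶ ≤ U₁`. In particular every witness
`(δ, U₁, U₂, c)` of the crux obeys this floor: the smaller `U₁`, the smaller the admissible `c`
(`c ≤ 48 (U₁/4)^{1/6}` once `c ≤ 1`). (`LoadBearing.birGroundStateAverageLRO_window_floor` with the
energy-cost rate now supplied by `freeDWavePairing_costs_energy_rate`.) [folklore] -/
theorem birGroundStateAverageLRO_window_floor_unconditional {δ U₁ U₂ c : ℝ}
    (hδ : δ ∈ Set.Ioo (0:ℝ) (1/2)) (hU₁ : 0 ≤ U₁) (hU : U₁ < U₂) (hc : 0 < c)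
    (h : ∀ U ∈ Set.Ioo U₁ U₂, ∃ L₀ : ℕ, ∀ (L : ℕ) [NeZero L], L₀ ≤ L → Even L →
      let N : ℕ := 2 * ⌊(1 - δ) * (L : ℝ) ^ 2 / 2⌋₊
      let H := hubbardTorus 2 L 1 U
      let S := szSector (Λ := FermionTorus 2 L) N 0
      let E₀ := S ⊓ Module.End.eigenspace (Matrix.toLin' H) ((H.minEnergyOn S : ℝ) : ℂ)
      let P := projMatrix (E₀.map (Fock.toEuclidean (ι := Orb (FermionTorus 2 L)) :
        Fock (Orb (FermionTorus 2 L)) →ₗ[ℂ] EuclideanSpace ℂ (Finset (Orb (FermionTorus 2 L)))))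
      c * (L : ℝ) ^ 4 * P.trace.re ≤
        (P * ((pairField dWaveFormFactor L)ᴴ * pairField dWaveFormFactor L)).trace.re) :
    4 * (min c 1 / 48) ^ 6 ≤ U₁ :=
  birGroundStateAverageLRO_window_floor hδ hU₁ hU h (η := 4 * (min c 1 / 48) ^ 6)
    (L₁ := ⌈384 / c⌉₊ + 3)
    (fun _ _ hL _ _ hS h1 hle => freeDWavePairing_costs_energy_rate hc hL hS h1 hle)

/-- **Corollary for the crux itself.** Any witness `(δ, U₁, U₂, c)` of `BirGroundStateAverageLRO`
(with its `0 < U₁`) has `4·(min(c,1)/48)⁶ ≤ U₁`. [folklore] -/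
theorem birGroundStateAverageLRO_witness_floor {δ U₁ U₂ c : ℝ}
    (hδ : δ ∈ Set.Ioo (0:ℝ) (1/2)) (hU₁ : 0 < U₁) (hU : U₁ < U₂) (hc : 0 < c)
    (h : ∀ U ∈ Set.Ioo U₁ U₂, ∃ L₀ : ℕ, ∀ (L : ℕ) [NeZero L], L₀ ≤ L → Even L →
      let N : ℕ := 2 * ⌊(1 - δ) * (L : ℝ) ^ 2 / 2⌋₊
      let H := hubbardTorus 2 L 1 U
      let S := szSector (Λ := FermionTorus 2 L) N 0
      let E₀ := S ⊓ Module.End.eigenspace (Matrix.toLin' H) ((H.minEnergyOn S : ℝ) : ℂ)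
      let P := projMatrix (E₀.map (Fock.toEuclidean (ι := Orb (FermionTorus 2 L)) :
        Fock (Orb (FermionTorus 2 L)) →ₗ[ℂ] EuclideanSpace ℂ (Finset (Orb (FermionTorus 2 L)))))
      c * (L : ℝ) ^ 4 * P.trace.re ≤
        (P * ((pairField dWaveFormFactor L)ᴴ * pairField dWaveFormFactor L)).trace.re) :
    4 * (min c 1 / 48) ^ 6 ≤ U₁ :=
  birGroundStateAverageLRO_window_floor_unconditional hδ hU₁.le hU hc h

/-- **Refuted strengthening (window from `0`), UNCONDITIONAL.** The variant of
`BirGroundStateAverageLRO` whose window is `(0, U₂)` with one constant `c` down to `U → 0⁺` is FALSE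
(`LoadBearing.not_birGroundStateAverageLRO_fromZero_of_pairingCost` with its hypothesis discharged by
`freeDWavePairing_costs_energy`). [folklore] -/
theorem not_birGroundStateAverageLRO_fromZero :
    ¬ ∃ δ ∈ Set.Ioo (0:ℝ) (1/2), ∃ U₂ c : ℝ, 0 < U₂ ∧ 0 < c ∧
        ∀ U ∈ Set.Ioo 0 U₂, ∃ L₀ : ℕ, ∀ (L : ℕ) [NeZero L], L₀ ≤ L → Even L →
          let N : ℕ := 2 * ⌊(1 - δ) * (L : ℝ) ^ 2 / 2⌋₊
          let H := hubbardTorus 2 L 1 U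
          let S := szSector (Λ := FermionTorus 2 L) N 0
          let E₀ := S ⊓ Module.End.eigenspace (Matrix.toLin' H) ((H.minEnergyOn S : ℝ) : ℂ)
          let P := projMatrix (E₀.map (Fock.toEuclidean (ι := Orb (FermionTorus 2 L)) :
            Fock (Orb (FermionTorus 2 L)) →ₗ[ℂ]
              EuclideanSpace ℂ (Finset (Orb (FermionTorus 2 L)))))
          c * (L : ℝ) ^ 4 * P.trace.re ≤
            (P * ((pairField dWaveFormFactor L)ᴴ * pairField dWaveFormFactor L)).trace.re :=
  not_birGroundStateAverageLRO_fromZero_of_pairingCost freeDWavePairing_costs_energy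

/-- **Registered stub `pairingCostWitnessFloor` (crux `stmt-HubbardSuperconductivity-2079`).** Every
witness `(δ, U₁, U₂, c)` of the crux satisfies the UNCONDITIONAL coupling floor
`4·(min(c,1)/48)⁶ ≤ U₁` (`birGroundStateAverageLRO_witness_floor`, one-line registered form).
[folklore] -/
theorem pairingCostWitnessFloor : ∀ (δ U₁ U₂ c : ℝ), δ ∈ Set.Ioo (0:ℝ) (1/2) → 0 < U₁ → U₁ < U₂ → 0 < c → (∀ U ∈ Set.Ioo U₁ U₂, ∃ L₀ : ℕ, ∀ (L : ℕ) [NeZero L], L₀ ≤ L → Even L → let N : ℕ := 2 * ⌊(1 - δ) * (L : ℝ) ^ 2 / 2⌋₊; let H := Literature.MathematicalPhysics.QuantumLattice.hubbardTorus 2 L 1 U; let S := Literature.MathematicalPhysics.QuantumLattice.szSector (Λ := Literature.MathematicalPhysics.QuantumLattice.FermionTorus 2 L) N 0; let E₀ := S ⊓ Module.End.eigenspace (Matrix.toLin' H) ((H.minEnergyOn S : ℝ) : ℂ); let P := Literature.MathematicalPhysics.QuantumLattice.projMatrix (E₀.map (Literature.MathematicalPhysics.QuantumLattice.Fock.toEuclidean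 (ι := Literature.MathematicalPhysics.QuantumLattice.Orb (Literature.MathematicalPhysics.QuantumLattice.FermionTorus 2 L)) : Literature.MathematicalPhysics.QuantumLattice.Fock (Literature.MathematicalPhysics.QuantumLattice.Orb (Literature.MathematicalPhysics.QuantumLattice.FermionTorus 2 L)) →ₗ[ℂ] EuclideanSpace ℂ (Finset (Literature.MathematicalPhysics.QuantumLattice.Orb (Literature.MathematicalPhysics.QuantumLattice.FermionTorus 2 L))))); c * (L : ℝ) ^ 4 * P.trace.re ≤ (P * (Matrix.conjTranspose (Literature.MathematicalPhysics.QuantumLattice.pairField Literature.MathematicalPhysics.QuantumLattice.dWaveFormFactor L) * Literature.MathematicalPhysics.QuantumLattice.pairField Literature.MathematicalPhysics.QuantumLattice.dWaveFormFactor L)).trace.re) → 4 * (min c 1 / 48) ^ 6 ≤ U₁ :=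
  fun _ _ _ _ hδ hU₁ hU hc h => birGroundStateAverageLRO_witness_floor hδ hU₁ hU hc h

end Summit.HubbardSuperconductivity.HubbardSuperconductivity.Theorems.BirGroundStateAverageLRO.Negative
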